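import Summits.QuantumFields.QCD.Theses.QuarksAsStableAction
import Summits.QuantumFields.QCD.Theses.RenormalisedVafaWitten
import Literature.MathematicalPhysics.QuantumFieldTheory.MassGapToLatticeClustering

/-!
# The shared threshold item `ThresholdQCD` (stmt-QuantumFields-8794) from the three shared laws — chessboard-free

Helper file (`--supports`), lead c12 of crux stmt-QuantumFields-17577 `WilsonQuarkChessboard.MassiveBridge`.

The crux `MassiveBridge` is `QuarkChessboard → FlatCellOptimal → Θ` with `Θ` definitionally the shared item
`QuarksAsStableAction.ThresholdQCD` (stmt-QuantumFields-8794; `massiveBridge_iff_imp_thresholdQCD`, p151841), and the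
line `registered` cuts `Θ` into three shared laws (p148760 / p148355 / p148819, composition p149234):

* (UV)  `RenormalisedVafaWitten.DynamicalQuarkContinuum` (stmt-QuantumFields-8695) — offset-free full continuum data;
* (IR-lattice)  `GradientFlowSpecies.MassiveLatticeGap` (stmt-QuantumFields-8922) — uniform lattice gap above a threshold;
* (IR-continuum)  the species clustering law in offset-free form (along data-carrying `(z, shift, T)` above a threshold
  the lattice theories cluster the smeared species correlators in Cauchy–Schwarz form at a positive rate), or, in the
  ledger-facing variant, `GradientFlowSpecies.GapTransfer` (stmt-QuantumFields-8923, as typed).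

The landed compositions (p149234) conclude `MassiveBridge`, i.e. `Θ` only behind the chessboard hypotheses `C ∧ K`,
and `thresholdQCD_of_massiveBridge` (p151841) needs `K` to get back to `Θ`.  Mathematically neither `C` nor `K` is
used: this file records the `K`-FREE compositions, concluding item 8794 by name, so that the three-law refinement is
visible on THAT item's record (it is the target of `HeavyThresholdYMBridge` and crux r7 of `QuarksAsStableAction`) and
composes with `massiveBridge_of_thresholdQCD` (p151841) back to the crux.  Both theorems are CONDITIONAL on open items;
nothing here claims progress on 8695 / 8922 / 8923 themselves.
-/

noncomputable section

namespace Summit.QuantumFields.QCD.Theorems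

open Literature.MathematicalPhysics.QuantumFieldTheory
open Summit.QuantumFields.QCD.Theses

/-! ### Records of the two GradientFlowSpecies items used below (buildfix ops lane 2026-08-20)

The route file `Theses/GradientFlowSpecies.lean` has not built since the 2026-08-16 re-type of the summit
statement `QCD` (its `closes` glue fails at :412; the ITEMS are unchanged), so this module — which only uses two of
its items as hypotheses — lost its build. Instead of importing that file, the two items are recorded HERE, in this
file's own namespace, with their LEDGER SIGNATURES VERBATIM (= the bodies of
`Summit.QuantumFields.QCD.Theses.GradientFlowSpecies.{MassiveLatticeGap, GapTransfer}` in the current route file):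
namespace resolution precedes the `open … Theses` above, so the statement text of every theorem below is unchanged
and denotes exactly the propositions it was accepted for. If the planners restate items 8922/8923, these records
(and the conditional theorems below) speak about the signatures recorded here. No accepted statement is edited. -/

/-- Record of item stmt-QuantumFields-8922 `GradientFlowSpecies.MassiveLatticeGap` (crux, open): ledger signature
verbatim — uniform lattice mass gap above a flavour-blind mass threshold for the data-carrying mass-independent
regularisations of `N_f ∈ {2,3}` QCD. A record of a ledger ITEM, not a published fact. -/
def GradientFlowSpecies.MassiveLatticeGap : Prop :=
  ∀ Nf : ℕ, Nf = 2 ∨ Nf = 3 → ∀ reg : Literature.MathematicalPhysics.QuantumFieldTheory.QCDRegularisation Nf, (reg.HasMassScaling ∧ ∀ m : Fin Nf → ℝ, (∀ f, 0 < m f) → ∃ (z shift : Literature.MathematicalPhysics.QuantumFieldTheory.QCDField Nf → ℕ → ℝ) (T : Literature.MathematicalPhysics.QuantumFieldTheory.OSData (Literature.MathematicalPhysics.QuantumFieldTheory.QCDField Nf) 4), Literature.MathematicalPhysics.QuantumFieldTheory.IsQCDAlong (reg.scheme m z shift) T ∧ T.IsNontrivial Literature.MathematicalPhysics.QuantumFieldTheory.QCDField.glue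 ∧ T.IsNonGaussian Literature.MathematicalPhysics.QuantumFieldTheory.QCDField.glue ∧ ∀ f g : Fin Nf, f ≠ g → T.IsNontrivial (Literature.MathematicalPhysics.QuantumFieldTheory.QCDField.pseudoRe f g)) → ∃ M : ℝ, ∀ m : Fin Nf → ℝ, (∀ f, M < m f) → ∃ Δ : ℝ, 0 < Δ ∧ (reg.scheme m 0 0).HasLatticeMassGap Δ

/-- Record of item stmt-QuantumFields-8923 `GradientFlowSpecies.GapTransfer` (support, open): ledger signature
verbatim — a uniform lattice gap at rate `Δ` along a scheme carrying OS data `T` transfers to `T.HasMassGap Δ'` for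
every `0 < Δ' < Δ`. A record of a ledger ITEM, not a published fact. -/
def GradientFlowSpecies.GapTransfer : Prop :=
  ∀ (Nf : ℕ) (sch : Literature.MathematicalPhysics.QuantumFieldTheory.QCDScheme Nf) (T : Literature.MathematicalPhysics.QuantumFieldTheory.OSData (Literature.MathematicalPhysics.QuantumFieldTheory.QCDField Nf) 4) (Δ Δ' : ℝ), 0 < Δ' → Δ' < Δ → Literature.MathematicalPhysics.QuantumFieldTheory.IsQCDAlong sch T → sch.HasLatticeMassGap Δ → T.HasMassGap Δ'

/-- The uniform lattice gap clause is antitone in the rate (constant `max C 0`). [folklore] -/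
private theorem tqsl_hasLatticeMassGap_mono {Nf : ℕ} (sch : QCDScheme Nf) {Δ Δ' : ℝ}
    (h : sch.HasLatticeMassGap Δ) (hle : Δ' ≤ Δ) : sch.HasLatticeMassGap Δ' := by
  intro R R' A B
  obtain ⟨C, hC⟩ := h R R' A B
  refine ⟨max C 0, ?_⟩
  filter_upwards [hC] with k hk S hS n hn
  have h1 := hk S hS n hn
  have han : 0 ≤ sch.a k * (n : ℝ) := mul_nonneg (sch.a_pos k).le (Nat.cast_nonneg n)
  have hexp : Real.exp (-(Δ * (sch.a k * n))) ≤ Real.exp (-(Δ' * (sch.a k * n))) :=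
    Real.exp_le_exp.2 (by nlinarith)
  exact h1.trans ((mul_le_mul_of_nonneg_right (le_max_left C 0) (Real.exp_pos _).le).trans
    (mul_le_mul_of_nonneg_left hexp (le_max_right C 0)))

/-- The continuum gap clause is antitone in the rate (constant `max C 0`). [folklore] -/
private theorem tqsl_hasMassGap_anti {Nf : ℕ} (T : OSData (QCDField Nf) 4) {Δ Δ' : ℝ}
    (h : T.HasMassGap Δ) (hle : Δ' ≤ Δ) : T.HasMassGap Δ' := by
  intro n m k k' F G hF hG
  obtain ⟨C, hC⟩ := h n m k k' F G hF hG
  refine ⟨max C 0, fun t ht H hH => ?_⟩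
  have h1 := hC t ht H hH
  have hexp : Real.exp (-Δ * t) ≤ Real.exp (-Δ' * t) := Real.exp_le_exp.2 (by nlinarith)
  exact h1.trans ((mul_le_mul_of_nonneg_right (le_max_left C 0) (Real.exp_pos _).le).trans
    (mul_le_mul_of_nonneg_left hexp (le_max_right C 0)))

/-- **`ThresholdQCD` from the three shared laws, chessboard-free.**  For `N_f ∈ {2,3}`: the shared UV half
`RenormalisedVafaWitten.DynamicalQuarkContinuum` (stmt-QuantumFields-8695) supplies one mass-independent
regularisation with `HasMassScaling` and full continuum data at every positive tuple; the shared lattice gap law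
`GradientFlowSpecies.MassiveLatticeGap` (stmt-QuantumFields-8922) a threshold `M` above which every tuple has a
uniform lattice gap `Δ₁ > 0`; the species clustering law (offset-free form) a threshold `M₂ ≥ 0` above which every
data-carrying `(z, shift, T)` clusters the smeared species correlators at a rate `Δ₂ > 0`, transferred to
`T.HasMassGap Δ₂` by the Literature theorem `IsQCDAlong.hasMassGap_of_hasSpeciesCSClustering`; above
`max (max M 0) M₂ ≥ 0` both gap clauses hold at the common rate `min Δ₁ Δ₂`.  This is the composition of the line
`registered` of crux stmt-QuantumFields-17577 read as a proof of item stmt-QuantumFields-8794, with the idle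
chessboard hypotheses `C ∧ K` removed.  CONDITIONAL on 8695, 8922 and the species clustering law.
[cite: JaffeWitten2000, §5] [cite: OsterwalderSeiler1978, §§2–4] [cite: Luscher1977] -/
theorem thresholdQCD_of_sharedLaws
    (hUV : RenormalisedVafaWitten.DynamicalQuarkContinuum)
    (hL : GradientFlowSpecies.MassiveLatticeGap)
    (hS : ∀ Nf : ℕ, Nf = 2 ∨ Nf = 3 → ∀ reg : QCDRegularisation Nf, reg.HasMassScaling →
      (∀ m : Fin Nf → ℝ, (∀ f, 0 < m f) →
        ∃ (z shift : QCDField Nf → ℕ → ℝ) (T : OSData (QCDField Nf) 4),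
          IsQCDAlong (reg.scheme m z shift) T ∧ T.IsNontrivial QCDField.glue ∧
            T.IsNonGaussian QCDField.glue ∧
              ∀ f g : Fin Nf, f ≠ g → T.IsNontrivial (QCDField.pseudoRe f g)) →
      ∃ M₂ : ℝ, 0 ≤ M₂ ∧ ∀ m : Fin Nf → ℝ, (∀ f, M₂ < m f) →
        ∀ (z shift : QCDField Nf → ℕ → ℝ) (T : OSData (QCDField Nf) 4),
          IsQCDAlong (reg.scheme m z shift) T →
            ∃ Δ : ℝ, 0 < Δ ∧ (reg.scheme m z shift).HasSpeciesCSClustering Δ) :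
    QuarksAsStableAction.ThresholdQCD := by
  unfold QuarksAsStableAction.ThresholdQCD
  intro Nf hNf
  obtain ⟨reg, hms, hdata⟩ := hUV Nf hNf
  obtain ⟨M, hM⟩ := hL Nf hNf reg ⟨hms, hdata⟩
  obtain ⟨M₂, hM₂, hcs⟩ := hS Nf hNf reg hms hdata
  refine ⟨max (max M 0) M₂, (le_max_right M 0).trans (le_max_left _ _), reg, hms, fun m hm => ?_⟩
  have hmM : ∀ f, M < m f := fun f => ((le_max_left M 0).trans (le_max_left _ _)).trans_lt (hm f)
  have hm0 : ∀ f, 0 < m f := fun f => ((le_max_right M 0).trans (le_max_left _ _)).trans_lt (hm f)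
  have hm2 : ∀ f, M₂ < m f := fun f => (le_max_right _ _).trans_lt (hm f)
  obtain ⟨z, shift, T, hqcd, hglue, hng, hps⟩ := hdata m hm0
  obtain ⟨Δ₁, hΔ₁, hlat⟩ := hM m hmM
  obtain ⟨Δ₂, hΔ₂, hclus⟩ := hcs m hm2 z shift T hqcd
  have hlat' : (reg.scheme m z shift).HasLatticeMassGap Δ₁ := hlat
  have hTgap : T.HasMassGap Δ₂ := hqcd.hasMassGap_of_hasSpeciesCSClustering hclus
  exact ⟨z, shift, T, hqcd, hglue, hng, hps, min Δ₁ Δ₂, lt_min hΔ₁ hΔ₂,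
    tqsl_hasMassGap_anti T hTgap (min_le_right _ _), tqsl_hasLatticeMassGap_mono _ hlat' (min_le_left _ _)⟩

/-- **`ThresholdQCD` from the GradientFlowSpecies route's open items, chessboard-free** (the ledger-facing form):
`DynamicalQuarkContinuum (8695) → MassiveLatticeGap (8922) → GapTransfer (8923) → ThresholdQCD (8794)` — the
lattice rate `Δ` above 8922's threshold is transferred to `T.HasMassGap (Δ/2)` by 8923 as typed and both clauses are
read at `Δ/2`.  Composed with `massiveBridge_of_thresholdQCD` (p151841) it recovers `massiveBridge_of_items`
(p149234); unlike the latter followed by `thresholdQCD_of_massiveBridge`, it does not pass through `FlatCellOptimal`.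
CONDITIONAL on three open items. [cite: JaffeWitten2000, §5] [cite: GlimmJaffe1987, §6.1 Thm. 6.1.3] -/
theorem thresholdQCD_of_items
    (hUV : RenormalisedVafaWitten.DynamicalQuarkContinuum)
    (hL : GradientFlowSpecies.MassiveLatticeGap) (hGT : GradientFlowSpecies.GapTransfer) :
    QuarksAsStableAction.ThresholdQCD := by
  unfold QuarksAsStableAction.ThresholdQCD
  intro Nf hNf
  obtain ⟨reg, hms, hdata⟩ := hUV Nf hNf
  obtain ⟨M, hM⟩ := hL Nf hNf reg ⟨hms, hdata⟩
  refine ⟨max M 0, le_max_right M 0, reg, hms, fun m hm => ?_⟩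
  have hmM : ∀ f, M < m f := fun f => (le_max_left M 0).trans_lt (hm f)
  have hm0 : ∀ f, 0 < m f := fun f => (le_max_right M 0).trans_lt (hm f)
  obtain ⟨z, shift, T, hqcd, hglue, hng, hps⟩ := hdata m hm0
  obtain ⟨Δ, hΔ, hlat⟩ := hM m hmM
  have hlat' : (reg.scheme m z shift).HasLatticeMassGap Δ := hlat
  have hTgap : T.HasMassGap (Δ / 2) :=
    hGT Nf (reg.scheme m z shift) T Δ (Δ / 2) (by positivity) (by linarith) hqcd hlat'
  exact ⟨z, shift, T, hqcd, hglue, hng, hps, Δ / 2, by positivity, hTgap,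
    tqsl_hasLatticeMassGap_mono _ hlat' (by linarith)⟩

end Summit.QuantumFields.QCD.Theorems

end
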